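import Literature.NumberTheory.Sieve.LinearEquationsInPrimes
import HarnessLib

/-!
# Barrier catalogue `Parity`: Maier-type irregularities of linear patterns of primes at small
# scales (Pandey–Woo 2024) — the short-box strengthening of the Green–Tao asymptotic is false

Catalogue entry (D-0021) for the summit `Parity`, sub-problem `GeneralizedHardyLittlewood`
(`Literature.NumberTheory.Sieve.GeneralizedHardyLittlewood`, Green–Tao 2010 Conj. 1.2, whose finite-complexity part is the
Green–Tao–Ziegler theorem `Literature.NumberTheory.Sieve.GreenTaoZiegler2012_finiteComplexity`). Both count prime values
of a system `Ψ` of affine-linear forms over convex bodies `K ⊆ [-N, N]^d` with error `o(N^d)` —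
a statement at the FULL scale `N`. The natural small-scale strengthening (the count in every box
of side `H = (log X)^λ` inside `[X, 2X]^d` is `∼ H^d (log X)^{-t} ∏_p β_p`, as a Cramér-type
model corrected by the local factors `β_p` predicts for `λ > 1`… `2`) is FALSE for every
finite-complexity system: Pandey and Woo prove "the analog to Maier's result on primes in short
intervals" for linear patterns (Theorem 5), by Maier's matrix method run through the Green–Tao
machinery (a `Q`-factor theorem for nilsequences in progressions to a smooth "dutiful" modulus,
and Matthiesen's asymptotics for linear patterns of rough numbers). The tree entry
`Literature/Barriers/Parity/EquidistributionLimits.lean` records Maier's theorem and the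
Granville–Soundararajan uncertainty principle for the primes themselves (`d = t = 1`) and for
subsets of the primes in progressions; this file is the linear-PATTERN (`t ≥ 1`, `d ≥ 1`,
finite complexity) statement and imports nothing from it.

* `shortBox x H`, `primePatternCount Ψ x H` — lattice points of `∏ⱼ [xⱼ, xⱼ + H]` and the number
  of them at which all `ψᵢ` take (positive) prime values (tree conventions: `Literature.NumberTheory.Sieve.AffLinForm`,
  values in `ℤ`, primality of `Int.toNat`, as in `Literature.NumberTheory.Sieve.primePointCount`);
* `SmallScalePatternIrregularity` — Pandey–Woo Theorem 5 (named fact; docstring = BARRIER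
  block), transcribed for systems of LINEAR forms with non-negative coefficients (so that all
  forms are positive and of size `≍ X` on the boxes; see `scope_caveats`) and in the
  "arbitrarily large `X`" form;
* `SmallScaleUniformity Ψ lam` — the Cramér-type small-scale asymptotic that the fact refutes,
  and the PROVED refutation `SmallScalePatternIrregularity.not_smallScaleUniformity` (for systems
  with `∏_p β_p > 0`);
* `fourAPSystem` — the paper's example `(x, x+y, x+2y, x+3y)` with the PROVED facts that it is a
  finite-complexity system in the scope of the fact (`fourAPSystem_inScope`).

## What the source prints (verified on the page; arXiv:2304.14267 page numbers)

* M. Pandey, K. Woo, *Small scale distribution of linear patterns of primes*, J. London Math.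
  Soc. (2) 110 (2024) e13001 [cite: PandeyWoo2024, Abstract, §1 (Theorems 1, 3, 4, 5, Corollary 2, Remark 1), §2 (Definition 2, Propositions 6–8, §2.4)].
  Abstract: "Let `Ψ` be a system of linear forms with finite complexity. In their seminal paper,
  Green and Tao showed the following prime number theorem for values of the system `Ψ`:
  `∑_{x ∈ [-N,N]^d} ∏_{i=1}^t 1_𝒫(ψᵢ(x)) ∼ (2N)^d (log N)^{-t} ∏_p β_p` … we show the analog to
  Maier's result on primes in short intervals. In particular, we show that for all `λ > 1`, there
  exist `δ_λ^± > 0` such that for `N` sufficiently large, there exist boxes `B^± ⊂ [-N, N]^d` of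
  sidelengths at least `(log N)^λ` such that `∑_{x ∈ B⁺} ∏ 1_𝒫(ψᵢ(x)) > (1+δ⁺) vol(B⁺)(log N)^{-t} ∏_p β_p`,
  `∑_{x ∈ B⁻} ∏ 1_𝒫(ψᵢ(x)) < (1-δ⁻) vol(B⁻)(log N)^{-t} ∏_p β_p`." §1, p. 3: Theorem 1 (Maier)
  in `limsup/liminf` form; "an analogue of Cramér's model might be to model
  `1_{n₁, n₂, N-n₁-n₂ prime}` by a random variable … This analogue of Cramér's model would
  suggest that one would be able to count such `nᵢ` in short intervals as short as `(log X)^λ`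
  for `λ > 2`. A special case of our main theorem provides an answer in the negative"
  (Corollary 2, `λ > 3/2`); "Our main theorem, however, can be applied to a broader class of
  equations that are beyond the reach of the circle method. For instance, we can instead
  consider primes in four term arithmetic progressions, and show similar irregularities in the
  distribution of `(x, y)` such that `x, x+y, x+2y, x+3y` are all prime." Definition 1
  (complexity); "a system has finite complexity if and only if the `ψ̃ᵢ` are pairwise linearly
  independent. In particular, twin primes and Goldbach's conjecture both have infinite
  complexity; as a result, we are not able to say anything about such primes using this
  technology." p. 4: Theorem 3 (Green–Tao): `∑_{x ∈ [-X,X]^d} ∏ Λ(ψᵢ(x)) = (2X)^d ∏_p β_p + o_Ψ(X^d)`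
  with `β_p = p^{-d} ∑_{x ∈ 𝔽_p^d} ∏ᵢ (p/(p-1)) 1_{(ψᵢ(x),p)=1}`; Theorem 4 (Matomäki–Shao–Tao–
  Teräväinen): the asymptotic in boxes `[X, X+H]^d`, `X^{5/8+ε} ≤ H ≤ X^{1-ε}`; Theorem 5:
  "Let `λ>1`, `X` sufficiently large, and `H=(log X)^λ`. Then, there exist `δ_λ⁺, δ_λ⁻ > 0`
  such that there exists `x^± ∈ [X,2X]^d` such that
  `∑_{x ∈ ∏ᵢ[xᵢ⁺, xᵢ⁺+H]} ∏ᵢ 1_{ψᵢ(x) is prime} ≥ (1+δ_λ⁺) H^d (log X)^{-t} ∏_p β_p` and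
  `∑_{x ∈ ∏ᵢ[xᵢ⁻, xᵢ⁻+H]} ∏ᵢ 1_{ψᵢ(x) is prime} ≤ (1-δ_λ⁻) H^d (log X)^{-t} ∏_p β_p`."
  §2.1: "We fix a system of form[s] `Ψ = (ψ₁,...,ψ_t): ℤ^d → ℝ` of finite complexity `s`."
  Definition 2 (dutiful modulus `Q`: no zeros `β > 1 - (log Q)^{-2}` of `L(s, χ)` for the
  relevant characters); Proposition 6: "There [are] arbitrarily large `z` such that `P(z)` is a
  dutiful modulus" (Landau–Page); Proposition 7 (pattern count in progressions `n ≡ a (Q)`,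
  `Q = P(z)` dutiful, `X ≥ exp((log Q)^{50})`); Proposition 8 (linear patterns of `z`-rough
  numbers in `[N, 2N]^d`, `N = z^u`: factor `(e^γ ω(u))^t`, `ω` = Buchstab's function; from
  Matthiesen); §2.4: "Take `Q = P(z)` a sufficiently large dutiful modulus, and let
  `X = Q⌊exp((log Q)^{100})/Q⌋`", Maier-matrix double counting of
  `Σ = ∑_{a ∈ [U,2U]^d} ∑_{n ∈ [X,2X]^d, n ≡ a (Q)} ∏ 1_𝒫(ψᵢ(n))`, "there must exist `r^±`",
  "The desired result follows from the fact that for any `u`, there exist `u⁺, u⁻ ≥ u` such that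
  `e^γ ω(u⁻) < 1 < e^γ ω(u⁺)` (see Lemma 4 in [Maier])", then pigeonholing inside boxes of side
  `U^± = z^{u^±}` down to side `(log X)^λ`.

Design / faithfulness. (1) The printed Theorem 5 is about an arbitrary finite-complexity system
with the positivity/sign conventions for "`ψᵢ(x)` is prime" on `[X, 2X]^d` left implicit; it is
transcribed for systems of LINEAR forms (`ψᵢ(0) = 0`) with NON-NEGATIVE coefficients, for
which every form is positive and `≍ X` on the boxes, so that no convention is needed (this
covers the paper's examples `(x, x+y, x+2y, x+3y)` and `(n)` = Maier). (2) "for `X` sufficiently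
large" is transcribed as "for arbitrarily large `X`" (what §2.4 produces: one scale
`X = Q⌊exp((log Q)^{100})/Q⌋` per dutiful `Q = P(z)`, `z` arbitrarily large by Proposition 6);
the printed form implies the transcribed one. (3) `δ^±` may here depend on `Ψ` as well as on
`λ` (printed: `δ_λ^±` for the fixed `Ψ` of §2.1). All three choices only weaken the named fact;
they are recorded in `scope_caveats`. The proof uses the Green–Tao–Ziegler inverse theorem,
nilsequence factorisation and Matthiesen's theorem; nothing of it is in Mathlib — named fact.

What IS proved in this tree (companion files, all sorry-free): the conclusion of the fact for
every in-scope system of ONE form, any `d` (`smallScalePatternIrregularity_fin_one`,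
`smallScalePatternIrregularity_dim_one`; `SmallScalePatternsProofs.lean` — Maier's matrix with the
tree's Page-type prime number theorem, a walk along a Bézout direction); for every in-scope system
admitting a DUAL FRAME `ψᵢ(v_l) = δ_{il}`, equivalently every onto system `ℤ^d → ℤ^t`
(complexity `0`, all `β_p = 1`), any `t, d` (`smallScalePatternIrregularity_of_frame`,
`smallScalePatternIrregularity_of_surjective`, e.g. `apSystem 2 = (x, x + y)`;
`SmallScalePatternsFrameProofs.lean` — one Maier row and `t − 1` long windows counted by the
prime number theorem); and, for the paper's example family of `k`-term progressions, the scope,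
`∏_p β_p > 0`, the unconditional refutation corollaries and "the fact implies Green–Tao's theorem"
(`SmallScalePatternsAP.lean`). The systems of complexity `≥ 1` (e.g. `fourAPSystem`) are NOT
covered by these proofs.
-/

noncomputable section

open Filter Finset Topology

namespace Literature.Barriers.Parity

variable {d t : ℕ}

/-! ## Boxes and pattern counts -/

/-- The lattice points of the box `∏ⱼ [xⱼ, xⱼ + H]` (`H ≥ 0` real; side `⌊H⌋` in lattice
terms). [cite: PandeyWoo2024, Theorem 5] -/
def shortBox (x : Fin d → ℕ) (H : ℝ) : Finset (Fin d → ℤ) :=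
  Fintype.piFinset fun j => Finset.Icc (x j : ℤ) ((x j : ℤ) + ⌊H⌋₊)

/-- `#{n ∈ ∏ⱼ [xⱼ, xⱼ + H] ∩ ℤ^d : ψ₁(n), …, ψ_t(n) prime}` (a value `m ∈ ℤ` is prime iff
`m.toNat` is a prime natural number, as in `Literature.NumberTheory.Sieve.primePointCount`). [cite: PandeyWoo2024, Theorem 5] -/
def primePatternCount (Ψ : Fin t → Literature.NumberTheory.Sieve.AffLinForm d) (x : Fin d → ℕ) (H : ℝ) : ℕ :=
  #((shortBox x H).filter fun n => ∀ i, ((Ψ i).eval n).toNat.Prime)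

/-- The scope of the transcription: finite complexity (tree `Literature.NumberTheory.Sieve.IsFiniteComplexitySystem`),
linear forms (`ψᵢ(0) = 0`), non-negative coefficients, no zero form.
[cite: PandeyWoo2024, §2.1 and Definition 1] -/
def InScope (Ψ : Fin t → Literature.NumberTheory.Sieve.AffLinForm d) : Prop :=
  Literature.NumberTheory.Sieve.IsFiniteComplexitySystem Ψ ∧ (∀ i, (Ψ i).const = 0) ∧ (∀ i j, 0 ≤ (Ψ i).coeff j) ∧
    ∀ i, (Ψ i).coeff ≠ 0

/-- The Cramér-type main term `H^d (log X)^{-t} ∏_p β_p` for boxes of side `H = (log X)^lam`.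
[cite: PandeyWoo2024, Theorem 5] -/
def smallScaleMainTerm (Ψ : Fin t → Literature.NumberTheory.Sieve.AffLinForm d) (lam : ℝ) (X : ℕ) : ℝ :=
  ((Real.log X) ^ lam) ^ d / (Real.log X) ^ t * Literature.NumberTheory.Sieve.singularProduct Ψ

/-! ## The barrier: Pandey–Woo, Theorem 5 -/

/-- **Pandey–Woo, Theorem 5 (small-scale irregularity of linear patterns of primes).** Let
`Ψ = (ψ₁, …, ψ_t) : ℤ^d → ℤ^t` (`d, t ≥ 1`) be a finite-complexity system of linear forms with
non-negative coefficients (`InScope Ψ`), and `lam > 1`. Then there are `δ⁺, δ⁻ > 0` such that for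
arbitrarily large `X`, with `H = (log X)^lam`, there exist `x⁺, x⁻ ∈ [X, 2X]^d` with
`#{n ∈ ∏ⱼ[xⱼ⁺, xⱼ⁺ + H] : all ψᵢ(n) prime} ≥ (1 + δ⁺) H^d (log X)^{-t} ∏_p β_p` and
`#{n ∈ ∏ⱼ[xⱼ⁻, xⱼ⁻ + H] : all ψᵢ(n) prime} ≤ (1 - δ⁻) H^d (log X)^{-t} ∏_p β_p`
(`∏_p β_p = Literature.singularProduct Ψ`, `β_p = Literature.localFactor Ψ p`). Named fact.
[cite: PandeyWoo2024, Theorem 5 and §2.4]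

BARRIER (D-0021; one line per key):
technique_class: Cramér/Granville-type random models of the primes corrected by the local factors `β_p`, and any method that would deliver the Green–Tao / generalised Hardy–Littlewood asymptotic for a finite-complexity system UNIFORMLY over all boxes of polylogarithmic side `H = (log X)^λ` inside `[X, 2X]^d` (`SmallScaleUniformity Ψ λ`) — "This analogue of Cramér's model would suggest that one would be able to count such `nᵢ` in short intervals as short as `(log X)^λ` for `λ > 2`. A special case of our main theorem provides an answer in the negative" [cite: PandeyWoo2024, §1 (p. 3) and Theorem 5].
blocks: the small-scale (short-box) strengthening of the finite-complexity prime number theorem for linear systems (tree `Literature.NumberTheory.Sieve.GreenTaoZiegler2012_finiteComplexity`; Green–Tao 2010 Main Theorem) and hence of `GeneralizedHardyLittlewood` restricted to finite complexity: for EVERY `λ > 1` some boxes of side `(log X)^λ` carry `(1+δ⁺)` times, others `(1-δ⁻)` times, the predicted number `H^d(log X)^{-t}∏_p β_p` of prime patterns (`SmallScalePatternIrregularity.not_smallScaleUniformity`, proved from the fact for systems with `∏_p β_p > 0`); printed instances: pairs `(p₁, p₂)` with `N - p₁ - p₂` prime in boxes of side `(log X)^λ`, `λ > 3/2` (Corollary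 2), and `(x, y)` with `x, x+y, x+2y, x+3y` all prime (`fourAPSystem_inScope`) [cite: PandeyWoo2024, Theorem 5, Corollary 2 and §1 (p. 3)].
because: Maier's matrix method: for a "dutiful" modulus `Q = P(z)` (no real zeros of the relevant `L(s,χ)` with `β > 1 - (log Q)^{-2}`; such `z` exist arbitrarily large by Landau–Page) and `X = Q⌊exp((log Q)^{100})/Q⌋`, the double sum `Σ = ∑_{a ∈ [U,2U]^d} ∑_{n ∈ [X,2X]^d, n ≡ a (Q)} ∏ᵢ 1_𝒫(ψᵢ(n))` is evaluated (i) row-wise by the Green–Tao machinery in progressions to the smooth modulus `Q` (Proposition 7, via a `Q`-factor theorem for nilsequences, Theorem 12) and (ii) column-wise as a count of linear patterns of `z`-rough numbers in `[U, 2U]^d`, `U = z^u` (Proposition 8, from Matthiesen), producing the factor `(e^γ ω(u))^t` with Buchstab's `ω`; since `e^γω(u) - 1` changes sign infinitely often ("for any `u`, there exist `u⁺, u⁻ ≥ u` such that `e^γ ω(u⁻) < 1 < e^γ ω(u⁺)`", Maier's Lemma 4), some sub-box `R_r` of side `U` is over- resp. under-populated, and pigeonholing inside it gives boxes of side `(log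 X)^λ` [cite: PandeyWoo2024, §2 (Definition 2, Propositions 6–8) and §2.4].
evasions_known: LARGER boxes: the asymptotic holds in all boxes `[X, X+H]^d` with `X^{5/8+ε} ≤ H ≤ X^{1-ε}` (Matomäki–Shao–Tao–Teräväinen) [cite: PandeyWoo2024, Theorem 4]; and at the full scale `[-X, X]^d` (Green–Tao, with Green–Tao–Ziegler; tree `Literature.NumberTheory.Sieve.GreenTaoZiegler2012_finiteComplexity`) [cite: PandeyWoo2024, Theorem 3]; for the primes themselves (`d = t = 1`) the corresponding statements and their evasions are catalogued in `Literature/Barriers/Parity/EquidistributionLimits.lean` (Maier 1985; Granville–Soundararajan 2007) [cite: PandeyWoo2024, Theorem 1].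
scope_caveats: (a) FINITE complexity only — "twin primes and Goldbach's conjecture both have infinite complexity; as a result, we are not able to say anything about such primes using this technology": the theorem says nothing about the open binary part of `GeneralizedHardyLittlewood` [cite: PandeyWoo2024, §1 (p. 3, after Definition 1)]; (b) it produces SOME badly distributed boxes of side `(log X)^λ` at the scales `X` considered, not a positive proportion of them, and nothing for boxes of side `X^θ` [cite: PandeyWoo2024, Theorem 5 and Theorem 4]; (c) transcription narrower than print in three respects, each only weakening the fact: systems of linear forms with non-negative coefficients (the print fixes "a system of forms `Ψ : ℤ^d → ℝ[sic]` of finite complexity" and leaves the sign convention in "`ψᵢ(x)` is prime" on `[X,2X]^d` implicit), "arbitrarily large `X`" instead of the printed "X sufficiently large" (§2.4 constructs one scale `X = Q⌊exp((log Q)^{100})/Q⌋` per dutiful `Q = P(z)`, and Proposition 6 gives dutiful `P(z)` only for arbitrarily large `z`), and `δ^±` allowed to depend on `Ψ` [cite: PandeyWoo2024, Theorem 5, §2.1, Proposition 6 and §2.4]; (d) Corollary 2 (`N - p₁ - p₂`, a form with a negative coefficient and constant term `N`, `N ≪ X ≤ N/6`) is outside the transcribed scope [cite: PandeyWoo2024,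 Corollary 2].
status: established -/
def SmallScalePatternIrregularity : Prop :=
  ∀ (d t : ℕ), 1 ≤ d → 1 ≤ t → ∀ Ψ : Fin t → Literature.NumberTheory.Sieve.AffLinForm d, InScope Ψ →
    ∀ lam : ℝ, 1 < lam → ∃ δp δm : ℝ, 0 < δp ∧ 0 < δm ∧
      ∀ X₀ : ℕ, ∃ X : ℕ, X₀ ≤ X ∧
        (∃ x : Fin d → ℕ, (∀ j, X ≤ x j ∧ x j ≤ 2 * X) ∧
          (1 + δp) * smallScaleMainTerm Ψ lam X ≤
            primePatternCount Ψ x ((Real.log X) ^ lam)) ∧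
        (∃ x : Fin d → ℕ, (∀ j, X ≤ x j ∧ x j ≤ 2 * X) ∧
          (primePatternCount Ψ x ((Real.log X) ^ lam) : ℝ) ≤
            (1 - δm) * smallScaleMainTerm Ψ lam X)

/-! ## The refuted strengthening -/

/-- **Cramér-type small-scale uniformity** for the system `Ψ` at box side `(log X)^lam`: for
every `ε > 0`, for all large `X` and ALL `x ∈ [X, 2X]^d`, the number of prime patterns in
`∏ⱼ [xⱼ, xⱼ + (log X)^lam]` is within a factor `1 ± ε` of `H^d (log X)^{-t} ∏_p β_p`. This is
the "analogue of Cramér's model" expectation for boxes of side `(log X)^λ`, which Theorem 5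
answers "in the negative". [cite: PandeyWoo2024, §1 (p. 3) and Theorem 5] -/
def SmallScaleUniformity (Ψ : Fin t → Literature.NumberTheory.Sieve.AffLinForm d) (lam : ℝ) : Prop :=
  ∀ ε : ℝ, 0 < ε → ∃ X₀ : ℕ, ∀ X : ℕ, X₀ ≤ X → ∀ x : Fin d → ℕ, (∀ j, X ≤ x j ∧ x j ≤ 2 * X) →
    |(primePatternCount Ψ x ((Real.log X) ^ lam) : ℝ) - smallScaleMainTerm Ψ lam X| ≤
      ε * smallScaleMainTerm Ψ lam X

/-- The main term is positive once `X ≥ 2` and `∏_p β_p > 0`. [folklore] -/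
lemma smallScaleMainTerm_pos {Ψ : Fin t → Literature.NumberTheory.Sieve.AffLinForm d} {lam : ℝ} (hS : 0 < Literature.NumberTheory.Sieve.singularProduct Ψ)
    {X : ℕ} (hX : 2 ≤ X) : 0 < smallScaleMainTerm Ψ lam X := by
  have hlog : 0 < Real.log (X : ℝ) := Real.log_pos (by exact_mod_cast hX)
  unfold smallScaleMainTerm
  have h1 : 0 < (Real.log (X : ℝ)) ^ lam := Real.rpow_pos_of_pos hlog lam
  positivity

/-- **Theorem 5 refutes Cramér-type small-scale uniformity** for every in-scope system with
`∏_p β_p > 0` and every `lam > 1`: at a scale `X` supplied by the fact, the over-populated box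
`x⁺` has at least `(1+δ⁺)M` prime patterns while uniformity with `ε < δ⁺` allows at most
`(1+ε)M`, `M = H^d(log X)^{-t}∏_p β_p > 0`. [cite: PandeyWoo2024, Theorem 5 and §1 (p. 3)] -/
theorem SmallScalePatternIrregularity.not_smallScaleUniformity (h : SmallScalePatternIrregularity)
    (hd : 1 ≤ d) (ht : 1 ≤ t) {Ψ : Fin t → Literature.NumberTheory.Sieve.AffLinForm d} (hΨ : InScope Ψ)
    (hS : 0 < Literature.NumberTheory.Sieve.singularProduct Ψ) {lam : ℝ} (hlam : 1 < lam) : ¬ SmallScaleUniformity Ψ lam := by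
  intro hU
  obtain ⟨δp, δm, hδp, -, hX⟩ := h d t hd ht Ψ hΨ lam hlam
  obtain ⟨X₀, hX₀⟩ := hU (δp / 2) (half_pos hδp)
  obtain ⟨X, hXge, ⟨x, hx, hcount⟩, -⟩ := hX (max X₀ 2)
  have hXX₀ : X₀ ≤ X := le_trans (le_max_left _ _) hXge
  have hX2 : 2 ≤ X := le_trans (le_max_right _ _) hXge
  have hM := smallScaleMainTerm_pos (lam := lam) hS hX2
  have hup := hX₀ X hXX₀ x hx
  rw [abs_le] at hup
  nlinarith [hup.2]

/-! ## An in-scope example: four-term progressions -/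

/-- The system `(x, x+y, x+2y, x+3y)` on `ℤ²` counting four-term arithmetic progressions of
primes (the paper's example). [cite: PandeyWoo2024, §1 (p. 3)] -/
def fourAPSystem : Fin 4 → Literature.NumberTheory.Sieve.AffLinForm 2 := fun i => ⟨![1, (i : ℤ)], 0⟩

/-- `(x, x+y, x+2y, x+3y)` is a finite-complexity system of linear forms with non-negative
coefficients, i.e. in the scope of `SmallScalePatternIrregularity`. [cite: PandeyWoo2024, §1 (p. 3) and Definition 1] -/
theorem fourAPSystem_inScope : InScope fourAPSystem := by
  refine ⟨?_, fun i => rfl, fun i j => ?_, fun i h => ?_⟩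
  · intro i j hij a b hab
    have h0 := congrFun hab 0
    have h1 := congrFun hab 1
    simp only [fourAPSystem, Pi.smul_apply, smul_eq_mul, Matrix.cons_val_zero,
      Matrix.cons_val_one, mul_one] at h0 h1
    subst h0
    have hij' : (i : ℤ) ≠ (j : ℤ) := by
      intro e; apply hij; ext; exact_mod_cast e
    have : a * ((i : ℤ) - (j : ℤ)) = 0 := by linarith
    rcases mul_eq_zero.1 this with ha | hsub
    · exact ⟨ha, ha⟩
    · exact absurd (sub_eq_zero.1 hsub) hij'
  · fin_cases j <;> simp [fourAPSystem]
  · have := congrFun h 0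
    simp [fourAPSystem] at this

end Literature.Barriers.Parity
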